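/-
Copyright (c) 2026 the pub-hodgecm-mathlib formalisation cell (harness21).  Prover seat hodgecm-mathlib-F0P3a-p07 (g14) ((Cnt2′) chair), sub-organ (z1-e′) of the
(T2) G-side count rows `stub_T2G_{zero,pm}`; owner F0P3a-p06 (g15); 2026-09-02.
-/
import Literature.NumberTheory.Automorphic.UnitaryLatticeTreeAnisotropicPlane      -- ★ p847364 (F0P3a-p03): `eq_stdLattice_of_isSelfDualLattice_of_anisotropic`, `isSelfDualLattice_stdLattice_diagonal`
import Literature.NumberTheory.Automorphic.UnitaryLatticeTreeAxisCountTransport    -- ★ p847750∕p847852 (this seat): (z1-d)∕(z1-e) `ncard_selfDual_fixed_axis_{eq,zero_eq,rankOne_class_eq,…}`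
import HarnessLib

/-!
# The fixed self-dual count of a residually anisotropic plane is `0` or `1`, and so is the axis term of the anisotropic type-(2) literal (Bruhat–Tits 1972 §10)

Topic `NumberTheory/Automorphic`; namespace `Literature.NumberTheory.Automorphic.UnitaryLatticeTree`.  THEOREMS ONLY (no definition, no instance, no notation, no named fact,
no `sorry`); kernel lane `--supports stmt-HodgeConjecture-24833`; datum-free (`K` with `Valued K ℤᵐ⁰`).  Cell `pub/hodgecm-mathlib`, crux H413; road «S3-ram» (count-neutral),
(T2) G-side organ (Cnt2′), sub-organ **(z1-e′) «ANISOTROPIC AXIS TERM»** (ROADMAP `F0/P3a/F0P3a-p07/g14/cnt2/ROADMAP-Cnt2-zero-pm.v1_1` §1′∕§3): the OPPOSITE-SIGN literal `t₁`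
of a type-(2) `γ_H` has block frame `ι-shape(H₂′, h′)` with `H₂′ = diag(d)` RESIDUALLY ANISOTROPIC (★ `UnitaryLatticeTreeAnisotropicPlane`); there the `W`-side has exactly one
self-dual lattice, the root `L₀ = 𝒪²` (★ `eq_stdLattice_of_isSelfDualLattice_of_anisotropic`), so
* §1 **`ncard_selfDual_fixed_eq_ite_of_anisotropic`**: for ANY label `P` and any `γ₂`, `#{B ∣ SD(diag d) B ∧ γ₂B = B ∧ P B} = (γ₂L₀ = L₀ ∧ P L₀ ? 1 : 0)` (+ the `= 1` ∕ `= 0` forms);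
* §2 the AXIS TERMS of the rows `0`, `1+`, `1−` for the block element `ι(γ₂, u)` (`u` 2-deep) on `ι-shape(diag d, h)` (`|h| = 1`), by ★ (z1-e) p847852:
  **`ncard_selfDual_fixed_axis_{zero,rankOne_class,rankOne_not_class}_eq_ite_of_anisotropic`** — each is `1` or `0` according to the tokens of `γ₂` AT THE ROOT;
* §3 the row-`0` axis term IN ENTRIES: **`ncard_selfDual_fixed_axis_zero_eq_ite_entry_of_anisotropic`** — `= (∀ i k, |(γ₂ − 1)_{ik}| ≤ |ϖ²| ? 1 : 0)` when `|det γ₂| = 1`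
  (p07 (g13)'s histogram law (L1) «`#{a = 0}(t₁) = 1`» with its level condition: the LEDGER's `t1: n_0 = 1|…` rows).
* §4 (ED. 2): with the block `γ₂` 2-DEEP (the type-(2) opposite literal) the anisotropic axis column is the CONSTANT `(bd, reg, 0, 1+, 1−) = (0, 0, 1, 0, 0)`:
  **`ncard_selfDual_fixed_axis_{zero_eq_one, rankOne_class_eq_zero, rankOne_not_class_eq_zero, reg_eq_zero, bd_eq_zero}_of_anisotropic_of_twoDeep`**.
HONEST LABEL: HC_CM is proved only modulo the 2 remaining named inputs (hLiu418 24832, h413 24833) until rung 0 closes; elementary lattice algebra, no books consequence.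

## References
* [BruhatTits1972] F. Bruhat, J. Tits, *Groupes réductifs sur un corps local I*, Publ. Math. IHÉS 41 (1972), §10 (the building of an anisotropic group is a point).
* [Jacobowitz1962] R. Jacobowitz, *Hermitian forms over local fields*, Amer. J. Math. 84 (1962), §7 Thm. 7.1.
* [Kottwitz1986] R. E. Kottwitz, *Base change for unit elements of Hecke algebras*, Compositio Math. 60 (1986), §3 (counting fixed lattices).
* [Rogawski1990] J. D. Rogawski, *Automorphic Representations of Unitary Groups in Three Variables*, Ann. of Math. Stud. 123 (1990), §4.8 Case (a) p. 53, §4.9 p. 55.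
-/

set_option autoImplicit false

noncomputable section

open scoped Valued WithZero Matrix MatrixGroups

namespace Literature.NumberTheory.Automorphic.UnitaryLatticeTree

open Literature.NumberTheory.Automorphic Literature.NumberTheory.Automorphic.HermitianLattice Literature.NumberTheory.Rogawski1990

variable {K : Type*} [Field K] [Valued K ℤᵐ⁰]

section Anisotropic

variable {σ : K →+* K} (hvσ : ∀ a, Valued.v (σ a) = Valued.v a) {d : Fin 2 → K} (hd : ∀ i, Valued.v (d i) = 1)
  (hanis₀ : ∀ c : K, Valued.v c ≤ 1 → Valued.v (d 0 + d 1 * (σ c * c)) = 1)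
  (hanis₁ : ∀ c : K, Valued.v c ≤ 1 → Valued.v (d 0 * (σ c * c) + d 1) = 1)

/-! ## §1 The fixed self-dual count of the anisotropic plane is an indicator -/

include hvσ hd hanis₀ hanis₁ in
/-- **THE LABELLED FIXED SELF-DUAL COUNT OF A RESIDUALLY ANISOTROPIC PLANE IS `1` OR `0`**: the only self-dual lattice is `L₀`, so for any `γ₂` and any label `P`,
`#{B ∣ SD B ∧ γ₂B = B ∧ P B} = 1` if `γ₂L₀ = L₀ ∧ P L₀`, else `0`. [cite: BruhatTits1972, §10] [cite: Jacobowitz1962, §7 Thm. 7.1] -/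
theorem ncard_selfDual_fixed_eq_ite_of_anisotropic {ϖ : K} (hϖ0 : ϖ ≠ 0) (hϖ1 : Valued.v ϖ ≤ 1) (γ₂ : GL (Fin 2) K)
    (P : Submodule 𝒪[K] (Fin 2 → K) → Prop) [Decidable (mapGL γ₂ (stdLattice K 2) = stdLattice K 2 ∧ P (stdLattice K 2))] :
    {B : Submodule 𝒪[K] (Fin 2 → K) | IsSelfDualLattice σ ϖ (Matrix.diagonal d) B ∧ mapGL γ₂ B = B ∧ P B}.ncard =
      if mapGL γ₂ (stdLattice K 2) = stdLattice K 2 ∧ P (stdLattice K 2) then 1 else 0 := by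
  have hSD₀ : IsSelfDualLattice σ ϖ (Matrix.diagonal d) (stdLattice K 2) := isSelfDualLattice_stdLattice_diagonal σ hϖ1 hd
  split_ifs with h
  · rw [Set.ncard_eq_one]
    refine ⟨stdLattice K 2, Set.eq_singleton_iff_unique_mem.2 ⟨⟨hSD₀, h.1, h.2⟩, ?_⟩⟩
    rintro B ⟨hB, -, -⟩
    exact eq_stdLattice_of_isSelfDualLattice_of_anisotropic hvσ hd hanis₀ hanis₁ hϖ0 hϖ1 hB
  · have hempty : {B : Submodule 𝒪[K] (Fin 2 → K) | IsSelfDualLattice σ ϖ (Matrix.diagonal d) B ∧ mapGL γ₂ B = B ∧ P B} = (∅ : Set _) := by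
      ext B
      simp only [Set.mem_setOf_eq, Set.mem_empty_iff_false, iff_false, not_and]
      intro hB hfix hP
      have hB₀ := eq_stdLattice_of_isSelfDualLattice_of_anisotropic hvσ hd hanis₀ hanis₁ hϖ0 hϖ1 hB
      subst hB₀
      exact h ⟨hfix, hP⟩
    rw [hempty, Set.ncard_empty]

include hvσ hd hanis₀ hanis₁ in
/-- The `= 1` form of `ncard_selfDual_fixed_eq_ite_of_anisotropic`. [cite: BruhatTits1972, §10] -/
theorem ncard_selfDual_fixed_eq_one_of_anisotropic {ϖ : K} (hϖ0 : ϖ ≠ 0) (hϖ1 : Valued.v ϖ ≤ 1) (γ₂ : GL (Fin 2) K)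
    (P : Submodule 𝒪[K] (Fin 2 → K) → Prop) (hfix : mapGL γ₂ (stdLattice K 2) = stdLattice K 2) (hP : P (stdLattice K 2)) :
    {B : Submodule 𝒪[K] (Fin 2 → K) | IsSelfDualLattice σ ϖ (Matrix.diagonal d) B ∧ mapGL γ₂ B = B ∧ P B}.ncard = 1 := by
  classical
  rw [ncard_selfDual_fixed_eq_ite_of_anisotropic hvσ hd hanis₀ hanis₁ hϖ0 hϖ1 γ₂ P, if_pos ⟨hfix, hP⟩]

include hvσ hd hanis₀ hanis₁ in
/-- The `= 0` form of `ncard_selfDual_fixed_eq_ite_of_anisotropic`. [cite: BruhatTits1972, §10] -/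
theorem ncard_selfDual_fixed_eq_zero_of_anisotropic {ϖ : K} (hϖ0 : ϖ ≠ 0) (hϖ1 : Valued.v ϖ ≤ 1) (γ₂ : GL (Fin 2) K)
    (P : Submodule 𝒪[K] (Fin 2 → K) → Prop) (h : ¬ (mapGL γ₂ (stdLattice K 2) = stdLattice K 2 ∧ P (stdLattice K 2))) :
    {B : Submodule 𝒪[K] (Fin 2 → K) | IsSelfDualLattice σ ϖ (Matrix.diagonal d) B ∧ mapGL γ₂ B = B ∧ P B}.ncard = 0 := by
  classical
  rw [ncard_selfDual_fixed_eq_ite_of_anisotropic hvσ hd hanis₀ hanis₁ hϖ0 hϖ1 γ₂ P, if_neg h]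

/-! ## §2 The axis terms of the rows `0`, `1±` for the anisotropic literal -/

include hd in
/-- `det diag(d)` is a unit. [cite: Jacobowitz1962, §7] -/
private theorem isUnit_det_diagonal_of_units : IsUnit (Matrix.diagonal d).det := by
  rw [Matrix.det_diagonal, isUnit_iff_ne_zero]
  exact Finset.prod_ne_zero_iff.2 fun i _ h0 => by have := hd i; rw [h0, map_zero] at this; exact zero_ne_one this

include hvσ hd hanis₀ hanis₁ in
/-- **AXIS TERM, ROW `0`, ANISOTROPIC LITERAL**: on `ι-shape(diag d, h)` (`|h| = 1`) with `u` 2-deep,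
`#{M ∣ SD, ι(γ₂,u)M = M, e₁ ∈ M, LEV(ϖ) ∧ LEV(ϖ²)} = (γ₂L₀ = L₀ ∧ LEV(ϖ)(γ₂,L₀) ∧ LEV(ϖ²)(γ₂,L₀) ? 1 : 0)`.
[cite: BruhatTits1972, §10] [cite: Kottwitz1986, §3] [cite: Rogawski1990, §4.8 Case (a) p. 53] -/
theorem ncard_selfDual_fixed_axis_zero_eq_ite_of_anisotropic {ϖ : K} (hϖ0 : ϖ ≠ 0) (hϖ1 : Valued.v ϖ < 1) {h : K} (hh : Valued.v h = 1)
    (γ₂ : GL (Fin 2) K) {u : GL (Fin 1) K} (hu2 : Valued.v ((u : Matrix (Fin 1) (Fin 1) K) 0 0 - 1) ≤ Valued.v (ϖ ^ 2))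
    [Decidable (mapGL γ₂ (stdLattice K 2) = stdLattice K 2 ∧
      ((stdLattice K 2).map ((Matrix.toLin' ((γ₂ : Matrix (Fin 2) (Fin 2) K) - 1)).restrictScalars 𝒪[K]) ≤ scaleLattice ϖ (stdLattice K 2) ∧
        (stdLattice K 2).map ((Matrix.toLin' ((γ₂ : Matrix (Fin 2) (Fin 2) K) - 1)).restrictScalars 𝒪[K]) ≤ scaleLattice (ϖ ^ 2) (stdLattice K 2)))] :
    {M : Submodule 𝒪[K] (Fin 3 → K) | IsSelfDualLattice σ ϖ (!![(Matrix.diagonal d) 0 0, 0, (Matrix.diagonal d) 0 1; 0, h, 0; (Matrix.diagonal d) 1 0, 0, (Matrix.diagonal d) 1 1] : Matrix (Fin 3) (Fin 3) K) M ∧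
        mapGL (endoGL (γ₂, u)) M = M ∧ (Pi.single 1 1 : Fin 3 → K) ∈ M ∧
        (M.map ((Matrix.toLin' (((endoGL (γ₂, u) : GL (Fin 3) K) : Matrix (Fin 3) (Fin 3) K) - 1)).restrictScalars 𝒪[K]) ≤ scaleLattice ϖ M ∧
          M.map ((Matrix.toLin' (((endoGL (γ₂, u) : GL (Fin 3) K) : Matrix (Fin 3) (Fin 3) K) - 1)).restrictScalars 𝒪[K]) ≤ scaleLattice (ϖ ^ 2) M)}.ncard =
      if mapGL γ₂ (stdLattice K 2) = stdLattice K 2 ∧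
          ((stdLattice K 2).map ((Matrix.toLin' ((γ₂ : Matrix (Fin 2) (Fin 2) K) - 1)).restrictScalars 𝒪[K]) ≤ scaleLattice ϖ (stdLattice K 2) ∧
            (stdLattice K 2).map ((Matrix.toLin' ((γ₂ : Matrix (Fin 2) (Fin 2) K) - 1)).restrictScalars 𝒪[K]) ≤ scaleLattice (ϖ ^ 2) (stdLattice K 2))
        then 1 else 0 := by
  rw [ncard_selfDual_fixed_axis_zero_eq σ hvσ hϖ0 hϖ1 (isUnit_det_diagonal_of_units hd) hh γ₂ hu2]
  exact ncard_selfDual_fixed_eq_ite_of_anisotropic hvσ hd hanis₀ hanis₁ hϖ0 hϖ1.le γ₂ _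

include hvσ hd hanis₀ hanis₁ in
/-- **AXIS TERM, ROW `1+`, ANISOTROPIC LITERAL** (class token present, any class constant `c₀`): the count is the indicator of
`γ₂L₀ = L₀ ∧ LEV(ϖ) ∧ ¬LEV(ϖ²) ∧ LEV₂(ϖ³) ∧ CLS(c₀)` read for `γ₂` at the root `L₀`. [cite: BruhatTits1972, §10] [cite: Kottwitz1986, §3] [cite: Rogawski1990, §4.8 Case (a) p. 53] -/
theorem ncard_selfDual_fixed_axis_rankOne_class_eq_ite_of_anisotropic {ϖ : K} (hϖ0 : ϖ ≠ 0) (hϖ1 : Valued.v ϖ < 1) {h : K} (hh : Valued.v h = 1)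
    (γ₂ : GL (Fin 2) K) {u : GL (Fin 1) K} (hu2 : Valued.v ((u : Matrix (Fin 1) (Fin 1) K) 0 0 - 1) ≤ Valued.v (ϖ ^ 2)) (c₀ : K)
    [Decidable (mapGL γ₂ (stdLattice K 2) = stdLattice K 2 ∧
      ((stdLattice K 2).map ((Matrix.toLin' ((γ₂ : Matrix (Fin 2) (Fin 2) K) - 1)).restrictScalars 𝒪[K]) ≤ scaleLattice ϖ (stdLattice K 2) ∧
        ¬ (stdLattice K 2).map ((Matrix.toLin' ((γ₂ : Matrix (Fin 2) (Fin 2) K) - 1)).restrictScalars 𝒪[K]) ≤ scaleLattice (ϖ ^ 2) (stdLattice K 2) ∧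
        (stdLattice K 2).map ((Matrix.toLin' (((γ₂ : Matrix (Fin 2) (Fin 2) K) - 1) ^ 2)).restrictScalars 𝒪[K]) ≤ scaleLattice (ϖ ^ 3) (stdLattice K 2) ∧
        ∃ y₂ ∈ stdLattice K 2, ∃ a : K, Valued.v a = 1 ∧
          Valued.v (ϖ⁻¹ * pairing σ (Matrix.diagonal d) y₂ ((((γ₂ : Matrix (Fin 2) (Fin 2) K)) - 1) *ᵥ y₂) - c₀ * a ^ 2) < 1))] :
    {M : Submodule 𝒪[K] (Fin 3 → K) | IsSelfDualLattice σ ϖ (!![(Matrix.diagonal d) 0 0, 0, (Matrix.diagonal d) 0 1; 0, h, 0; (Matrix.diagonal d) 1 0, 0, (Matrix.diagonal d) 1 1] : Matrix (Fin 3) (Fin 3) K) M ∧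
        mapGL (endoGL (γ₂, u)) M = M ∧ (Pi.single 1 1 : Fin 3 → K) ∈ M ∧
        (M.map ((Matrix.toLin' (((endoGL (γ₂, u) : GL (Fin 3) K) : Matrix (Fin 3) (Fin 3) K) - 1)).restrictScalars 𝒪[K]) ≤ scaleLattice ϖ M ∧
          ¬ M.map ((Matrix.toLin' (((endoGL (γ₂, u) : GL (Fin 3) K) : Matrix (Fin 3) (Fin 3) K) - 1)).restrictScalars 𝒪[K]) ≤ scaleLattice (ϖ ^ 2) M ∧
          M.map ((Matrix.toLin' ((((endoGL (γ₂, u) : GL (Fin 3) K) : Matrix (Fin 3) (Fin 3) K) - 1) ^ 2)).restrictScalars 𝒪[K]) ≤ scaleLattice (ϖ ^ 3) M ∧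
          ∃ y ∈ M, ∃ a : K, Valued.v a = 1 ∧
            Valued.v (ϖ⁻¹ * pairing σ (!![(Matrix.diagonal d) 0 0, 0, (Matrix.diagonal d) 0 1; 0, h, 0; (Matrix.diagonal d) 1 0, 0, (Matrix.diagonal d) 1 1] : Matrix (Fin 3) (Fin 3) K) y
              ((((endoGL (γ₂, u) : GL (Fin 3) K) : Matrix (Fin 3) (Fin 3) K) - 1) *ᵥ y) - c₀ * a ^ 2) < 1)}.ncard =
      if mapGL γ₂ (stdLattice K 2) = stdLattice K 2 ∧
          ((stdLattice K 2).map ((Matrix.toLin' ((γ₂ : Matrix (Fin 2) (Fin 2) K) - 1)).restrictScalars 𝒪[K]) ≤ scaleLattice ϖ (stdLattice K 2) ∧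
            ¬ (stdLattice K 2).map ((Matrix.toLin' ((γ₂ : Matrix (Fin 2) (Fin 2) K) - 1)).restrictScalars 𝒪[K]) ≤ scaleLattice (ϖ ^ 2) (stdLattice K 2) ∧
            (stdLattice K 2).map ((Matrix.toLin' (((γ₂ : Matrix (Fin 2) (Fin 2) K) - 1) ^ 2)).restrictScalars 𝒪[K]) ≤ scaleLattice (ϖ ^ 3) (stdLattice K 2) ∧
            ∃ y₂ ∈ stdLattice K 2, ∃ a : K, Valued.v a = 1 ∧
              Valued.v (ϖ⁻¹ * pairing σ (Matrix.diagonal d) y₂ ((((γ₂ : Matrix (Fin 2) (Fin 2) K)) - 1) *ᵥ y₂) - c₀ * a ^ 2) < 1)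
        then 1 else 0 := by
  rw [ncard_selfDual_fixed_axis_rankOne_class_eq σ hvσ hϖ0 hϖ1 (isUnit_det_diagonal_of_units hd) hh γ₂ hu2 c₀]
  exact ncard_selfDual_fixed_eq_ite_of_anisotropic hvσ hd hanis₀ hanis₁ hϖ0 hϖ1.le γ₂ _

include hvσ hd hanis₀ hanis₁ in
/-- **AXIS TERM, ROW `1−`, ANISOTROPIC LITERAL** (class token absent, any class constant `c₀`): the count is the indicator of
`γ₂L₀ = L₀ ∧ LEV(ϖ) ∧ ¬LEV(ϖ²) ∧ LEV₂(ϖ³) ∧ ¬CLS(c₀)` read for `γ₂` at the root `L₀`. [cite: BruhatTits1972, §10] [cite: Kottwitz1986, §3] [cite: Rogawski1990, §4.8 Case (a) p. 53] -/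
theorem ncard_selfDual_fixed_axis_rankOne_not_class_eq_ite_of_anisotropic {ϖ : K} (hϖ0 : ϖ ≠ 0) (hϖ1 : Valued.v ϖ < 1) {h : K} (hh : Valued.v h = 1)
    (γ₂ : GL (Fin 2) K) {u : GL (Fin 1) K} (hu2 : Valued.v ((u : Matrix (Fin 1) (Fin 1) K) 0 0 - 1) ≤ Valued.v (ϖ ^ 2)) (c₀ : K)
    [Decidable (mapGL γ₂ (stdLattice K 2) = stdLattice K 2 ∧
      ((stdLattice K 2).map ((Matrix.toLin' ((γ₂ : Matrix (Fin 2) (Fin 2) K) - 1)).restrictScalars 𝒪[K]) ≤ scaleLattice ϖ (stdLattice K 2) ∧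
        ¬ (stdLattice K 2).map ((Matrix.toLin' ((γ₂ : Matrix (Fin 2) (Fin 2) K) - 1)).restrictScalars 𝒪[K]) ≤ scaleLattice (ϖ ^ 2) (stdLattice K 2) ∧
        (stdLattice K 2).map ((Matrix.toLin' (((γ₂ : Matrix (Fin 2) (Fin 2) K) - 1) ^ 2)).restrictScalars 𝒪[K]) ≤ scaleLattice (ϖ ^ 3) (stdLattice K 2) ∧
        ¬ ∃ y₂ ∈ stdLattice K 2, ∃ a : K, Valued.v a = 1 ∧
          Valued.v (ϖ⁻¹ * pairing σ (Matrix.diagonal d) y₂ ((((γ₂ : Matrix (Fin 2) (Fin 2) K)) - 1) *ᵥ y₂) - c₀ * a ^ 2) < 1))] :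
    {M : Submodule 𝒪[K] (Fin 3 → K) | IsSelfDualLattice σ ϖ (!![(Matrix.diagonal d) 0 0, 0, (Matrix.diagonal d) 0 1; 0, h, 0; (Matrix.diagonal d) 1 0, 0, (Matrix.diagonal d) 1 1] : Matrix (Fin 3) (Fin 3) K) M ∧
        mapGL (endoGL (γ₂, u)) M = M ∧ (Pi.single 1 1 : Fin 3 → K) ∈ M ∧
        (M.map ((Matrix.toLin' (((endoGL (γ₂, u) : GL (Fin 3) K) : Matrix (Fin 3) (Fin 3) K) - 1)).restrictScalars 𝒪[K]) ≤ scaleLattice ϖ M ∧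
          ¬ M.map ((Matrix.toLin' (((endoGL (γ₂, u) : GL (Fin 3) K) : Matrix (Fin 3) (Fin 3) K) - 1)).restrictScalars 𝒪[K]) ≤ scaleLattice (ϖ ^ 2) M ∧
          M.map ((Matrix.toLin' ((((endoGL (γ₂, u) : GL (Fin 3) K) : Matrix (Fin 3) (Fin 3) K) - 1) ^ 2)).restrictScalars 𝒪[K]) ≤ scaleLattice (ϖ ^ 3) M ∧
          ¬ ∃ y ∈ M, ∃ a : K, Valued.v a = 1 ∧
            Valued.v (ϖ⁻¹ * pairing σ (!![(Matrix.diagonal d) 0 0, 0, (Matrix.diagonal d) 0 1; 0, h, 0; (Matrix.diagonal d) 1 0, 0, (Matrix.diagonal d) 1 1] : Matrix (Fin 3) (Fin 3) K) y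
              ((((endoGL (γ₂, u) : GL (Fin 3) K) : Matrix (Fin 3) (Fin 3) K) - 1) *ᵥ y) - c₀ * a ^ 2) < 1)}.ncard =
      if mapGL γ₂ (stdLattice K 2) = stdLattice K 2 ∧
          ((stdLattice K 2).map ((Matrix.toLin' ((γ₂ : Matrix (Fin 2) (Fin 2) K) - 1)).restrictScalars 𝒪[K]) ≤ scaleLattice ϖ (stdLattice K 2) ∧
            ¬ (stdLattice K 2).map ((Matrix.toLin' ((γ₂ : Matrix (Fin 2) (Fin 2) K) - 1)).restrictScalars 𝒪[K]) ≤ scaleLattice (ϖ ^ 2) (stdLattice K 2) ∧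
            (stdLattice K 2).map ((Matrix.toLin' (((γ₂ : Matrix (Fin 2) (Fin 2) K) - 1) ^ 2)).restrictScalars 𝒪[K]) ≤ scaleLattice (ϖ ^ 3) (stdLattice K 2) ∧
            ¬ ∃ y₂ ∈ stdLattice K 2, ∃ a : K, Valued.v a = 1 ∧
              Valued.v (ϖ⁻¹ * pairing σ (Matrix.diagonal d) y₂ ((((γ₂ : Matrix (Fin 2) (Fin 2) K)) - 1) *ᵥ y₂) - c₀ * a ^ 2) < 1)
        then 1 else 0 := by
  rw [ncard_selfDual_fixed_axis_rankOne_not_class_eq σ hvσ hϖ0 hϖ1 (isUnit_det_diagonal_of_units hd) hh γ₂ hu2 c₀]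
  exact ncard_selfDual_fixed_eq_ite_of_anisotropic hvσ hd hanis₀ hanis₁ hϖ0 hϖ1.le γ₂ _

/-! ## §3 The row-`0` axis term of the anisotropic literal, in entries -/

/-- `LEV(c)` of `γ₂` at the root `L₀` is the entrywise condition `|(γ₂ − 1)_{ik}| ≤ |c|`. [cite: Kottwitz1986, §3] [cite: Serre1980Trees, Ch. II §1.1] -/
theorem map_sub_one_stdLattice_le_scaleLattice_iff {c : K} (hc : c ≠ 0) (γ₂ : GL (Fin 2) K) :
    (stdLattice K 2).map ((Matrix.toLin' ((γ₂ : Matrix (Fin 2) (Fin 2) K) - 1)).restrictScalars 𝒪[K]) ≤ scaleLattice c (stdLattice K 2) ↔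
      ∀ i k, Valued.v ((((γ₂ : Matrix (Fin 2) (Fin 2) K)) - 1) i k) ≤ Valued.v c := by
  have h := map_sub_one_latt_le_scaleLattice_iff hc γ₂ 1
  rwa [Units.val_one, latt_one, inv_one, one_mul, mul_one] at h

/-- An element `γ₂` with `|(γ₂ − 1)_{ik}| < 1` and `|det γ₂| = 1` fixes the root: `γ₂L₀ = L₀`. [cite: Serre1980Trees, Ch. II §1.1] [cite: Kottwitz1986, §3] -/
theorem mapGL_stdLattice_eq_of_forall_v_sub_one_lt_one (γ₂ : GL (Fin 2) K) (hγ : ∀ i k, Valued.v ((((γ₂ : Matrix (Fin 2) (Fin 2) K)) - 1) i k) < 1) :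
    mapGL γ₂ (stdLattice K 2) = stdLattice K 2 := by
  rw [mapGL_stdLattice_eq_iff]
  refine ⟨fun i k => ?_, ?_⟩
  · have e : (γ₂ : Matrix (Fin 2) (Fin 2) K) i k = (((γ₂ : Matrix (Fin 2) (Fin 2) K)) - 1) i k + (1 : Matrix (Fin 2) (Fin 2) K) i k := by
      simp [Matrix.sub_apply]
    rw [e]
    refine (Valuation.map_add _ _ _).trans (max_le (hγ i k).le ?_)
    rcases eq_or_ne i k with rfl | hik
    · simp
    · simp [Matrix.one_apply_ne hik]
  · rw [Matrix.coe_units_inv]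
    exact isIntMatrix_nonsing_inv_of_forall_v_sub_one_lt_one _ hγ

include hvσ hd hanis₀ hanis₁ in
/-- **AXIS TERM, ROW `0`, ANISOTROPIC LITERAL, IN ENTRIES**: on `ι-shape(diag d, h)` (`|h| = 1`), `u` 2-deep, `|ϖ| < 1`:
`#{M ∣ SD, ι(γ₂,u)M = M, e₁ ∈ M, LEV(ϖ) ∧ LEV(ϖ²)} = (∀ i k, |(γ₂ − 1)_{ik}| ≤ |ϖ²| ? 1 : 0)` — the anisotropic literal contributes ONE axis vertex to the row `0` exactly
when its `W`-block is 2-deep at the root (p07 (g13) LEDGER rows `t1: n_0 = 1|…`). [cite: BruhatTits1972, §10] [cite: Kottwitz1986, §3] [cite: Rogawski1990, §4.8 Case (a) p. 53] -/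
theorem ncard_selfDual_fixed_axis_zero_eq_ite_entry_of_anisotropic {ϖ : K} (hϖ0 : ϖ ≠ 0) (hϖ1 : Valued.v ϖ < 1) {h : K} (hh : Valued.v h = 1)
    (γ₂ : GL (Fin 2) K) {u : GL (Fin 1) K} (hu2 : Valued.v ((u : Matrix (Fin 1) (Fin 1) K) 0 0 - 1) ≤ Valued.v (ϖ ^ 2))
    [Decidable (∀ i k, Valued.v ((((γ₂ : Matrix (Fin 2) (Fin 2) K)) - 1) i k) ≤ Valued.v (ϖ ^ 2))] :
    {M : Submodule 𝒪[K] (Fin 3 → K) | IsSelfDualLattice σ ϖ (!![(Matrix.diagonal d) 0 0, 0, (Matrix.diagonal d) 0 1; 0, h, 0; (Matrix.diagonal d) 1 0, 0, (Matrix.diagonal d) 1 1] : Matrix (Fin 3) (Fin 3) K) M ∧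
        mapGL (endoGL (γ₂, u)) M = M ∧ (Pi.single 1 1 : Fin 3 → K) ∈ M ∧
        (M.map ((Matrix.toLin' (((endoGL (γ₂, u) : GL (Fin 3) K) : Matrix (Fin 3) (Fin 3) K) - 1)).restrictScalars 𝒪[K]) ≤ scaleLattice ϖ M ∧
          M.map ((Matrix.toLin' (((endoGL (γ₂, u) : GL (Fin 3) K) : Matrix (Fin 3) (Fin 3) K) - 1)).restrictScalars 𝒪[K]) ≤ scaleLattice (ϖ ^ 2) M)}.ncard =
      if ∀ i k, Valued.v ((((γ₂ : Matrix (Fin 2) (Fin 2) K)) - 1) i k) ≤ Valued.v (ϖ ^ 2) then 1 else 0 := by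
  classical
  have hϖ2 : Valued.v (ϖ ^ 2) ≤ Valued.v ϖ := by
    rw [map_pow, pow_two]
    calc Valued.v ϖ * Valued.v ϖ ≤ Valued.v ϖ * 1 := mul_le_mul' le_rfl hϖ1.le
      _ = Valued.v ϖ := mul_one _
  have hϖ2lt : Valued.v (ϖ ^ 2) < 1 := by rw [map_pow]; exact pow_lt_one₀ zero_le hϖ1 two_ne_zero
  rw [ncard_selfDual_fixed_axis_zero_eq_ite_of_anisotropic hvσ hd hanis₀ hanis₁ hϖ0 hϖ1 hh γ₂ hu2,
    map_sub_one_stdLattice_le_scaleLattice_iff hϖ0, map_sub_one_stdLattice_le_scaleLattice_iff (pow_ne_zero 2 hϖ0)]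
  by_cases hE : ∀ i k, Valued.v ((((γ₂ : Matrix (Fin 2) (Fin 2) K)) - 1) i k) ≤ Valued.v (ϖ ^ 2)
  · rw [if_pos hE, if_pos]
    exact ⟨mapGL_stdLattice_eq_of_forall_v_sub_one_lt_one γ₂ fun i k => (hE i k).trans_lt hϖ2lt, fun i k => (hE i k).trans hϖ2, hE⟩
  · rw [if_neg hE, if_neg]
    exact fun H => hE H.2.2

/-! ## §4 ED. 2 — the anisotropic literal with a 2-DEEP block: the axis column is the constant vector `(bd, reg, 0, 1+, 1−) = (0, 0, 1, 0, 0)`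

For the type-(2) opposite literal the `W`-block `γ₂` is 2-deep at the root (`|(γ₂ − 1)_{ik}| ≤ |ϖ²|`, A-p19 (g28)'s ★ frame `exists_vDeep_oppositeLiteral_frame_ram`), so the
token `LEV(ϖ²)` HOLDS at `L₀` and every row whose token contains `¬LEV(ϖ²)` (reg, 1+, 1−) or `¬LEV(ϖ)` (bd) has axis term `0`, while row `0` has axis term `1` — the LEDGER's
`t1: n_j = 1|…` (row 0) and `0|…` (rows bd, reg, 1±) axis digits (p07 (g13) `LEDGER-type2-strata`). -/

include hvσ hd hanis₀ hanis₁ in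
/-- **ROW `0`, ANISOTROPIC LITERAL, 2-DEEP BLOCK: the axis term is `1`.** [cite: BruhatTits1972, §10] [cite: Kottwitz1986, §3] [cite: Rogawski1990, §4.8 Case (a) p. 53, §4.9 p. 55] -/
theorem ncard_selfDual_fixed_axis_zero_eq_one_of_anisotropic_of_twoDeep {ϖ : K} (hϖ0 : ϖ ≠ 0) (hϖ1 : Valued.v ϖ < 1) {h : K} (hh : Valued.v h = 1)
    (γ₂ : GL (Fin 2) K) (hγ2 : ∀ i k, Valued.v ((((γ₂ : Matrix (Fin 2) (Fin 2) K)) - 1) i k) ≤ Valued.v (ϖ ^ 2))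
    {u : GL (Fin 1) K} (hu2 : Valued.v ((u : Matrix (Fin 1) (Fin 1) K) 0 0 - 1) ≤ Valued.v (ϖ ^ 2)) :
    {M : Submodule 𝒪[K] (Fin 3 → K) | IsSelfDualLattice σ ϖ (!![(Matrix.diagonal d) 0 0, 0, (Matrix.diagonal d) 0 1; 0, h, 0; (Matrix.diagonal d) 1 0, 0, (Matrix.diagonal d) 1 1] : Matrix (Fin 3) (Fin 3) K) M ∧
        mapGL (endoGL (γ₂, u)) M = M ∧ (Pi.single 1 1 : Fin 3 → K) ∈ M ∧
        (M.map ((Matrix.toLin' (((endoGL (γ₂, u) : GL (Fin 3) K) : Matrix (Fin 3) (Fin 3) K) - 1)).restrictScalars 𝒪[K]) ≤ scaleLattice ϖ M ∧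
          M.map ((Matrix.toLin' (((endoGL (γ₂, u) : GL (Fin 3) K) : Matrix (Fin 3) (Fin 3) K) - 1)).restrictScalars 𝒪[K]) ≤ scaleLattice (ϖ ^ 2) M)}.ncard = 1 := by
  classical
  rw [ncard_selfDual_fixed_axis_zero_eq_ite_entry_of_anisotropic hvσ hd hanis₀ hanis₁ hϖ0 hϖ1 hh γ₂ hu2, if_pos hγ2]

include hvσ hd hanis₀ hanis₁ in
/-- **ROW `1+`, ANISOTROPIC LITERAL, 2-DEEP BLOCK: the axis term is `0`** (any class constant `c₀`). [cite: BruhatTits1972, §10] [cite: Kottwitz1986, §3] [cite: Rogawski1990, §4.8 Case (a) p. 53, §4.9 p. 55] -/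
theorem ncard_selfDual_fixed_axis_rankOne_class_eq_zero_of_anisotropic_of_twoDeep {ϖ : K} (hϖ0 : ϖ ≠ 0) (hϖ1 : Valued.v ϖ < 1) {h : K} (hh : Valued.v h = 1)
    (γ₂ : GL (Fin 2) K) (hγ2 : ∀ i k, Valued.v ((((γ₂ : Matrix (Fin 2) (Fin 2) K)) - 1) i k) ≤ Valued.v (ϖ ^ 2))
    {u : GL (Fin 1) K} (hu2 : Valued.v ((u : Matrix (Fin 1) (Fin 1) K) 0 0 - 1) ≤ Valued.v (ϖ ^ 2)) (c₀ : K) :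
    {M : Submodule 𝒪[K] (Fin 3 → K) | IsSelfDualLattice σ ϖ (!![(Matrix.diagonal d) 0 0, 0, (Matrix.diagonal d) 0 1; 0, h, 0; (Matrix.diagonal d) 1 0, 0, (Matrix.diagonal d) 1 1] : Matrix (Fin 3) (Fin 3) K) M ∧
        mapGL (endoGL (γ₂, u)) M = M ∧ (Pi.single 1 1 : Fin 3 → K) ∈ M ∧
        (M.map ((Matrix.toLin' (((endoGL (γ₂, u) : GL (Fin 3) K) : Matrix (Fin 3) (Fin 3) K) - 1)).restrictScalars 𝒪[K]) ≤ scaleLattice ϖ M ∧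
          ¬ M.map ((Matrix.toLin' (((endoGL (γ₂, u) : GL (Fin 3) K) : Matrix (Fin 3) (Fin 3) K) - 1)).restrictScalars 𝒪[K]) ≤ scaleLattice (ϖ ^ 2) M ∧
          M.map ((Matrix.toLin' ((((endoGL (γ₂, u) : GL (Fin 3) K) : Matrix (Fin 3) (Fin 3) K) - 1) ^ 2)).restrictScalars 𝒪[K]) ≤ scaleLattice (ϖ ^ 3) M ∧
          ∃ y ∈ M, ∃ a : K, Valued.v a = 1 ∧
            Valued.v (ϖ⁻¹ * pairing σ (!![(Matrix.diagonal d) 0 0, 0, (Matrix.diagonal d) 0 1; 0, h, 0; (Matrix.diagonal d) 1 0, 0, (Matrix.diagonal d) 1 1] : Matrix (Fin 3) (Fin 3) K) y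
              ((((endoGL (γ₂, u) : GL (Fin 3) K) : Matrix (Fin 3) (Fin 3) K) - 1) *ᵥ y) - c₀ * a ^ 2) < 1)}.ncard = 0 := by
  rw [ncard_selfDual_fixed_axis_rankOne_class_eq σ hvσ hϖ0 hϖ1 (isUnit_det_diagonal_of_units hd) hh γ₂ hu2 c₀]
  exact ncard_selfDual_fixed_eq_zero_of_anisotropic hvσ hd hanis₀ hanis₁ hϖ0 hϖ1.le γ₂ _
    fun H => H.2.2.1 ((map_sub_one_stdLattice_le_scaleLattice_iff (pow_ne_zero 2 hϖ0) γ₂).2 hγ2)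

include hvσ hd hanis₀ hanis₁ in
/-- **ROW `1−`, ANISOTROPIC LITERAL, 2-DEEP BLOCK: the axis term is `0`** (any class constant `c₀`). [cite: BruhatTits1972, §10] [cite: Kottwitz1986, §3] [cite: Rogawski1990, §4.8 Case (a) p. 53, §4.9 p. 55] -/
theorem ncard_selfDual_fixed_axis_rankOne_not_class_eq_zero_of_anisotropic_of_twoDeep {ϖ : K} (hϖ0 : ϖ ≠ 0) (hϖ1 : Valued.v ϖ < 1) {h : K} (hh : Valued.v h = 1)
    (γ₂ : GL (Fin 2) K) (hγ2 : ∀ i k, Valued.v ((((γ₂ : Matrix (Fin 2) (Fin 2) K)) - 1) i k) ≤ Valued.v (ϖ ^ 2))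
    {u : GL (Fin 1) K} (hu2 : Valued.v ((u : Matrix (Fin 1) (Fin 1) K) 0 0 - 1) ≤ Valued.v (ϖ ^ 2)) (c₀ : K) :
    {M : Submodule 𝒪[K] (Fin 3 → K) | IsSelfDualLattice σ ϖ (!![(Matrix.diagonal d) 0 0, 0, (Matrix.diagonal d) 0 1; 0, h, 0; (Matrix.diagonal d) 1 0, 0, (Matrix.diagonal d) 1 1] : Matrix (Fin 3) (Fin 3) K) M ∧
        mapGL (endoGL (γ₂, u)) M = M ∧ (Pi.single 1 1 : Fin 3 → K) ∈ M ∧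
        (M.map ((Matrix.toLin' (((endoGL (γ₂, u) : GL (Fin 3) K) : Matrix (Fin 3) (Fin 3) K) - 1)).restrictScalars 𝒪[K]) ≤ scaleLattice ϖ M ∧
          ¬ M.map ((Matrix.toLin' (((endoGL (γ₂, u) : GL (Fin 3) K) : Matrix (Fin 3) (Fin 3) K) - 1)).restrictScalars 𝒪[K]) ≤ scaleLattice (ϖ ^ 2) M ∧
          M.map ((Matrix.toLin' ((((endoGL (γ₂, u) : GL (Fin 3) K) : Matrix (Fin 3) (Fin 3) K) - 1) ^ 2)).restrictScalars 𝒪[K]) ≤ scaleLattice (ϖ ^ 3) M ∧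
          ¬ ∃ y ∈ M, ∃ a : K, Valued.v a = 1 ∧
            Valued.v (ϖ⁻¹ * pairing σ (!![(Matrix.diagonal d) 0 0, 0, (Matrix.diagonal d) 0 1; 0, h, 0; (Matrix.diagonal d) 1 0, 0, (Matrix.diagonal d) 1 1] : Matrix (Fin 3) (Fin 3) K) y
              ((((endoGL (γ₂, u) : GL (Fin 3) K) : Matrix (Fin 3) (Fin 3) K) - 1) *ᵥ y) - c₀ * a ^ 2) < 1)}.ncard = 0 := by
  rw [ncard_selfDual_fixed_axis_rankOne_not_class_eq σ hvσ hϖ0 hϖ1 (isUnit_det_diagonal_of_units hd) hh γ₂ hu2 c₀]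
  exact ncard_selfDual_fixed_eq_zero_of_anisotropic hvσ hd hanis₀ hanis₁ hϖ0 hϖ1.le γ₂ _
    fun H => H.2.2.1 ((map_sub_one_stdLattice_le_scaleLattice_iff (pow_ne_zero 2 hϖ0) γ₂).2 hγ2)

include hvσ hd hanis₀ hanis₁ in
/-- **ROW `reg`, ANISOTROPIC LITERAL, 2-DEEP BLOCK: the axis term is `0`.** [cite: BruhatTits1972, §10] [cite: Kottwitz1986, §3] [cite: Rogawski1990, §4.8 Case (a) p. 53, §4.9 p. 55] -/
theorem ncard_selfDual_fixed_axis_reg_eq_zero_of_anisotropic_of_twoDeep {ϖ : K} (hϖ0 : ϖ ≠ 0) (hϖ1 : Valued.v ϖ < 1) {h : K} (hh : Valued.v h = 1)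
    (γ₂ : GL (Fin 2) K) (hγ2 : ∀ i k, Valued.v ((((γ₂ : Matrix (Fin 2) (Fin 2) K)) - 1) i k) ≤ Valued.v (ϖ ^ 2))
    {u : GL (Fin 1) K} (hu2 : Valued.v ((u : Matrix (Fin 1) (Fin 1) K) 0 0 - 1) ≤ Valued.v (ϖ ^ 2)) :
    {M : Submodule 𝒪[K] (Fin 3 → K) | IsSelfDualLattice σ ϖ (!![(Matrix.diagonal d) 0 0, 0, (Matrix.diagonal d) 0 1; 0, h, 0; (Matrix.diagonal d) 1 0, 0, (Matrix.diagonal d) 1 1] : Matrix (Fin 3) (Fin 3) K) M ∧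
        mapGL (endoGL (γ₂, u)) M = M ∧ (Pi.single 1 1 : Fin 3 → K) ∈ M ∧
        (M.map ((Matrix.toLin' (((endoGL (γ₂, u) : GL (Fin 3) K) : Matrix (Fin 3) (Fin 3) K) - 1)).restrictScalars 𝒪[K]) ≤ scaleLattice ϖ M ∧
          ¬ M.map ((Matrix.toLin' (((endoGL (γ₂, u) : GL (Fin 3) K) : Matrix (Fin 3) (Fin 3) K) - 1)).restrictScalars 𝒪[K]) ≤ scaleLattice (ϖ ^ 2) M ∧
          ¬ M.map ((Matrix.toLin' ((((endoGL (γ₂, u) : GL (Fin 3) K) : Matrix (Fin 3) (Fin 3) K) - 1) ^ 2)).restrictScalars 𝒪[K]) ≤ scaleLattice (ϖ ^ 3) M)}.ncard = 0 := by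
  rw [ncard_selfDual_fixed_axis_reg_eq σ hvσ hϖ0 hϖ1 (isUnit_det_diagonal_of_units hd) hh γ₂ hu2]
  exact ncard_selfDual_fixed_eq_zero_of_anisotropic hvσ hd hanis₀ hanis₁ hϖ0 hϖ1.le γ₂ _
    fun H => H.2.2.1 ((map_sub_one_stdLattice_le_scaleLattice_iff (pow_ne_zero 2 hϖ0) γ₂).2 hγ2)

include hvσ hd hanis₀ hanis₁ in
/-- **ROW `bd`, ANISOTROPIC LITERAL, 2-DEEP BLOCK: the axis term is `0`** (`LEV(ϖ²) ⇒ LEV(ϖ)` at the root). [cite: BruhatTits1972, §10] [cite: Kottwitz1986, §3] [cite: Rogawski1990, §4.8 Case (a) p. 53, §4.9 p. 55] -/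
theorem ncard_selfDual_fixed_axis_bd_eq_zero_of_anisotropic_of_twoDeep {ϖ : K} (hϖ0 : ϖ ≠ 0) (hϖ1 : Valued.v ϖ < 1) {h : K} (hh : Valued.v h = 1)
    (γ₂ : GL (Fin 2) K) (hγ2 : ∀ i k, Valued.v ((((γ₂ : Matrix (Fin 2) (Fin 2) K)) - 1) i k) ≤ Valued.v (ϖ ^ 2))
    {u : GL (Fin 1) K} (hu2 : Valued.v ((u : Matrix (Fin 1) (Fin 1) K) 0 0 - 1) ≤ Valued.v (ϖ ^ 2)) :
    {M : Submodule 𝒪[K] (Fin 3 → K) | IsSelfDualLattice σ ϖ (!![(Matrix.diagonal d) 0 0, 0, (Matrix.diagonal d) 0 1; 0, h, 0; (Matrix.diagonal d) 1 0, 0, (Matrix.diagonal d) 1 1] : Matrix (Fin 3) (Fin 3) K) M ∧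
        mapGL (endoGL (γ₂, u)) M = M ∧ (Pi.single 1 1 : Fin 3 → K) ∈ M ∧
        ¬ M.map ((Matrix.toLin' (((endoGL (γ₂, u) : GL (Fin 3) K) : Matrix (Fin 3) (Fin 3) K) - 1)).restrictScalars 𝒪[K]) ≤ scaleLattice ϖ M}.ncard = 0 := by
  have hϖ2 : Valued.v (ϖ ^ 2) ≤ Valued.v ϖ := by
    rw [map_pow, pow_two]
    calc Valued.v ϖ * Valued.v ϖ ≤ Valued.v ϖ * 1 := mul_le_mul' le_rfl hϖ1.le
      _ = Valued.v ϖ := mul_one _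
  rw [ncard_selfDual_fixed_axis_bd_eq σ hvσ hϖ0 hϖ1 (isUnit_det_diagonal_of_units hd) hh γ₂ hu2]
  exact ncard_selfDual_fixed_eq_zero_of_anisotropic hvσ hd hanis₀ hanis₁ hϖ0 hϖ1.le γ₂ _
    fun H => H.2 ((map_sub_one_stdLattice_le_scaleLattice_iff hϖ0 γ₂).2 fun i k => (hγ2 i k).trans hϖ2)

end Anisotropic

end Literature.NumberTheory.Automorphic.UnitaryLatticeTree
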